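import Literature.NumberTheory.Automorphic.ResiduallyTrivialFixedCosetCount            -- ★ ROW-0: `rank_redMat_sub_one_eq_zero_iff_forall_valuation_le` (any uniformising element)
import Literature.NumberTheory.Automorphic.UnitaryGroupReductionSurjectiveOfTwo         -- ★ (m1) §1 p846840 (this seat): `unitary_residueHom_surjective_of_isUnit_two` (Hensel at `v ∤ 2`, ramified included)
import Literature.NumberTheory.Automorphic.UnitaryGroupIntegralPointsReductionRamified -- ★ D-T1u-ram: `residueHom_galAdicCompletionMap_eq_id_of_ramified` (`σ̄_w = id`)
import Literature.NumberTheory.Automorphic.UnitaryGroupIntegralPointsReductionInert    -- ★ §4 transport (place-free): `exists_residueField_ringHom_galAdicCompletionMap`, `mem_integer_galAdicCompletionMap`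
import Literature.NumberTheory.Automorphic.LocalUnitaryIntegralLevel                   -- ★ `cmLocalIntegralLevel`, `mem_localIntegralLevel_iff_of_smul_eq`
import Literature.NumberTheory.Automorphic.ValuedFieldValuativeRelBridge               -- ★ `isUniformizingElement_of_v_eq`, `v_le_iff_valuation_le`
import Literature.NumberTheory.Automorphic.UnitaryGroupInertPlaceHyperbolicBasis       -- ★ `placeForm_hermitian_of_smul_eq`, `galAdicCompletionMap_galAdicCompletionMap_of_smul_eq` (place-free)
import Literature.NumberTheory.Automorphic.UnitaryGroupFormTransport                   -- ★ `formCongr`, `conj_mem_unitaryGroupOfForm`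
import Literature.NumberTheory.Rogawski1990.U3SupercuspidalJacquetVanishing           -- ★ `coe_localNonsplitEquiv_apply` (rfl)
import Literature.GroupTheory.SpecificGroups.OrthogonalThreeUnipotentJordanClasses     -- ★ E-fin-ram (F0P3-p03 (g14), p846826): `exists_conj_eq_of_rank_sub_one_eq_of_orthogonal`, `mem_unitaryGroupOfForm_smul_iff`
import Literature.NumberTheory.Rogawski1990.LevelOnePieceStrataConstancyRamified   -- ★ p846857 (this seat): (U)-ram depth 0 + §A/§B transport lemmas
import HarnessLib

/-!
# «(U)-ram DEPTH 1» (S3-ram row, desk table v1.2; CENSUS-VB-ram 5aa3c19d §0.4∕§1): a `v`-level-1 (= `w`-level-2) `K`-class piece at a tame-ramified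
# `w` is constant on the depth-1 strata `{k ∈ K : k_w ≡ 1 (ϖ_w), red(ϖ_w⁻¹(k_w − 1)) ∈ 𝒪}`, `𝒪` an `O(J̄)(𝔽_q)`-orbit in the symmetric layer `𝔭` (CENSUS-VB-ram §0.4 ∕ §1)
Topic `NumberTheory/Rogawski1990`; namespace `Literature.NumberTheory.Rogawski1990`.  THEOREMS ONLY (no definition, no instance, no notation, no named fact, no `sorry`).  Hand F0P3a-p05 (g15), 2026-09-01.
THE MATHEMATICS.  At a tame-ramified `w` the congruence ladder of the special `K = U(H′)(𝒪_v)` reads `K ⊃ K_w(1) ⊃ K_w(2) = K(ϖ_v)`, `K∕K_w(1) = O(J̄)(𝔽_q)`, `K_w(1)∕K_w(2) = 𝔭 = {X̄ : J̄X̄ symmetric}`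
(from `σϖ_w = −ϖ_w`).  A `v`-LEVEL-1 piece `g` (Ad `K`-invariant, left `K(ϖ_v)`-invariant) is a class function on `K∕K(ϖ_v)`; on the DEPTH-1 collar `K_w(1)` its classes over `k̄ = 1` are the
`O(J̄)(𝔽_q)`-orbits of the depth-1 residue `N(k) = red(ϖ_w⁻¹(k_w − 1))`.  THIS FILE: if `N(k)` and `N(k′)` are `O(J̄)`-conjugate then `g k = g k′` — lift the residual conjugator to `y ∈ K`
by Hensel at `v ∤ 2` (★ p846840), read `N(yky⁻¹) = ȳ N(k) ȳ⁻¹ = N(k′)` (★ `redMat_mul`), so `u := k′(yky⁻¹)⁻¹ ≡ 1 (ϖ_w²)` and `g k′ = g(yky⁻¹) = g k`.  No RIGID input; the orbit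
LIST (rank × residue square class) is the finite half ★ (β′) `OrthogonalThreeSymmetricNilpotentOrbitsNotByRank` (F0P3-p03 (g14)), not used here.
HONEST LABEL: HC_CM is proved only modulo the 2 remaining named inputs (hLiu418 24832, h413 24833) until rung 0 closes; unconditional local algebra, no books consequence.

## References
* [Rogawski1990] J. D. Rogawski, *Automorphic Representations of Unitary Groups in Three Variables* (1990): §4.9 p. 54, §3.9 p. 32, §1.10 p. 9.
* [PlatonovRapinchuk1994] V. Platonov, A. Rapinchuk, *Algebraic Groups and Number Theory* (1994): §3.3.
-/

set_option autoImplicit false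

noncomputable section

open NumberField IsDedekindDomain Matrix ValuativeRel
open Literature.NumberTheory.Automorphic Literature.NumberTheory.GaloisRepresentations Literature.NumberTheory.Automorphic.UnitaryGroup
open Literature.NumberTheory.Automorphic.IntegralReduction Literature.GroupTheory.SpecificGroups
open scoped Matrix MatrixGroups ValuativeRel

namespace Literature.NumberTheory.Rogawski1990

set_option maxHeartbeats 800000 in
/-- **(U)-ram DEPTH 1.**  `g` Ad `K`-invariant and left-invariant under `{u : u_w ≡ 1 (ϖ_w²)} = K(ϖ_v)`; `k, k′ ∈ K` with `k_w ≡ k′_w ≡ 1 (ϖ_w)` whose depth-1 residues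
`red(ϖ_w⁻¹(k_w − 1))`, `red(ϖ_w⁻¹(k′_w − 1))` are conjugate under the residual orthogonal group `O(red H′_w)(𝓀_w)`; then `g k = g k′`.  (Hensel ★ p846840 lifts the conjugator; no RIGID input.)
[cite: Rogawski1990, §4.9 p. 54; §3.9 p. 32] [cite: PlatonovRapinchuk1994, §3.3] -/
theorem apply_eq_apply_of_depthOne_conj_ramified
    (L : Type) [Field L] [NumberField L] [IsCMField L] (H' : Matrix (Fin 3) (Fin 3) L)
    {v : HeightOneSpectrum (𝓞 ↥(maximalRealSubfield L))}
    (hH' : (H'.map (cmConjRingHom L)).transpose = H') (w : PlacesOver L v)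
    (hw : IsCMField.complexConj L • w.1 = w.1) (he : v.asIdeal.ramificationIdx' w.1.asIdeal ≠ 1)
    (hH'w : IsUnit (placeForm H' w.1)) (hH'i : hH'w.unit ∈ glInt 3 (w.1.adicCompletion L))
    (h2 : IsUnit (2 : 𝒪[(w.1.adicCompletion L)]))
    (ϖ : (w.1.adicCompletion L)) (hϖ : Valued.v ϖ = WithZero.exp (-1 : ℤ))
    (g : ((cmDatum L 3 H').Local v) → ℂ)
    (hginv : ∀ u ∈ (cmLocalIntegralLevel L 3 H' v), ∀ x, g (u * x * u⁻¹) = g x)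
    (hg2w : ∀ u : ((cmDatum L 3 H').Local v),
      (∀ a b, Valued.v ((ϖ ^ 2)⁻¹ *
        (((((localNonsplitEquiv (IsCMField.complexConj L) H' (IsCMField.complexConj_ne_one L) w hw u) : ↥(unitaryGroupOfForm (galAdicCompletionMap (L := L) (IsCMField.complexConj L) hw) (placeForm H' w.1))) : GL (Fin 3) (w.1.adicCompletion L)) : Matrix (Fin 3) (Fin 3) (w.1.adicCompletion L)) a b - (1 : Matrix (Fin 3) (Fin 3) (w.1.adicCompletion L)) a b)) ≤ 1) →
      ∀ x, g (u * x) = g x)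
    {k k' : ((cmDatum L 3 H').Local v)} (hk : k ∈ (cmLocalIntegralLevel L 3 H' v)) (hk' : k' ∈ (cmLocalIntegralLevel L 3 H' v))
    (hk1 : ∀ a b, Valued.v (ϖ⁻¹ * ((((k).val : GL (Fin 3) (UnitaryGroup.LocalRing L v)).val.map (Pi.evalRingHom (fun w' : PlacesOver L v => w'.1.adicCompletion L) w)) a b - (1 : Matrix (Fin 3) (Fin 3) (w.1.adicCompletion L)) a b)) ≤ 1)
    (hk1' : ∀ a b, Valued.v (ϖ⁻¹ * ((((k').val : GL (Fin 3) (UnitaryGroup.LocalRing L v)).val.map (Pi.evalRingHom (fun w' : PlacesOver L v => w'.1.adicCompletion L) w)) a b - (1 : Matrix (Fin 3) (Fin 3) (w.1.adicCompletion L)) a b)) ≤ 1)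
    (hconj : ∃ h : GL (Fin 3) 𝓀[(w.1.adicCompletion L)], h ∈ unitaryGroupOfForm (RingHom.id 𝓀[(w.1.adicCompletion L)]) (redMat (placeForm H' w.1)) ∧
      (h : Matrix (Fin 3) (Fin 3) 𝓀[(w.1.adicCompletion L)]) * redMat (ϖ⁻¹ • ((((k).val : GL (Fin 3) (UnitaryGroup.LocalRing L v)).val.map (Pi.evalRingHom (fun w' : PlacesOver L v => w'.1.adicCompletion L) w)) - 1)) * ((h⁻¹ : GL (Fin 3) 𝓀[(w.1.adicCompletion L)]) : Matrix (Fin 3) (Fin 3) 𝓀[(w.1.adicCompletion L)])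
        = redMat (ϖ⁻¹ • ((((k').val : GL (Fin 3) (UnitaryGroup.LocalRing L v)).val.map (Pi.evalRingHom (fun w' : PlacesOver L v => w'.1.adicCompletion L) w)) - 1))) :
    g k = g k' := by
  classical
  have hc1 : IsCMField.complexConj L ≠ 1 := IsCMField.complexConj_ne_one L
  -- §0 the place `w`: involution `σ_w`, its integral ∕ residual avatars, Frobenius, `|𝓀_w| = q²`, the `σ`-fixed uniformizer
  have hσO : ∀ x : 𝒪[(w.1.adicCompletion L)], (galAdicCompletionMap (L := L) (IsCMField.complexConj L) hw) x ∈ 𝒪[(w.1.adicCompletion L)] := mem_integer_galAdicCompletionMap (IsCMField.complexConj L) v w hw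
  have hσσ : ∀ x, (galAdicCompletionMap (L := L) (IsCMField.complexConj L) hw) ((galAdicCompletionMap (L := L) (IsCMField.complexConj L) hw) x) = x := fun x => galAdicCompletionMap_galAdicCompletionMap_of_smul_eq (IsCMField.complexConj L) w hc1 hw x
  obtain ⟨σk, hσk⟩ := exists_residueField_ringHom_galAdicCompletionMap (IsCMField.complexConj L) v w hw
  have hidx : ∀ y, σk y = y := residueHom_galAdicCompletionMap_eq_self_of_ramified (IsCMField.complexConj L) v hc1 w hw he σk hσO hσk
  have hid : σk = RingHom.id _ := RingHom.ext hidx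
  have hϖu : IsUniformizingElement ϖ := isUniformizingElement_of_v_eq hϖ
  have h2k : (2 : 𝓀[(w.1.adicCompletion L)]) ≠ 0 := by
    have h := h2.map (IsLocalRing.residue 𝒪[(w.1.adicCompletion L)])
    rw [map_ofNat] at h
    exact h.ne_zero
  -- §1 the form `J = H′_w` and its integral model `J_𝒪` (unimodular, `σ_w`-hermitian)
  have hJint : ∀ i j, (placeForm H' w.1) i j ∈ 𝒪[(w.1.adicCompletion L)] := fun i j => ((mem_glInt_iff _).1 hH'i).1 i j
  have hJinv : ∀ i j, (((hH'w.unit⁻¹ : (Matrix (Fin 3) (Fin 3) (w.1.adicCompletion L))ˣ) : Matrix (Fin 3) (Fin 3) (w.1.adicCompletion L))) i j ∈ 𝒪[(w.1.adicCompletion L)] :=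
    fun i j => ((mem_glInt_iff _).1 hH'i).2 i j
  let JO : Matrix (Fin 3) (Fin 3) 𝒪[(w.1.adicCompletion L)] := Matrix.of fun i j => ⟨(placeForm H' w.1) i j, hJint i j⟩
  have hJ : (placeForm H' w.1) = JO.map ((↑) : 𝒪[(w.1.adicCompletion L)] → (w.1.adicCompletion L)) := by ext i j; rfl
  have hinjO : Function.Injective (fun M : Matrix (Fin 3) (Fin 3) 𝒪[(w.1.adicCompletion L)] => M.map ((↑) : 𝒪[(w.1.adicCompletion L)] → (w.1.adicCompletion L))) :=
    Matrix.map_injective Subtype.val_injective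
  have hJOdet : IsUnit JO.det := by
    let JI : Matrix (Fin 3) (Fin 3) 𝒪[(w.1.adicCompletion L)] :=
      Matrix.of fun i j => ⟨(((hH'w.unit⁻¹ : (Matrix (Fin 3) (Fin 3) (w.1.adicCompletion L))ˣ) : Matrix (Fin 3) (Fin 3) (w.1.adicCompletion L))) i j, hJinv i j⟩
    have hJI : (((hH'w.unit⁻¹ : (Matrix (Fin 3) (Fin 3) (w.1.adicCompletion L))ˣ) : Matrix (Fin 3) (Fin 3) (w.1.adicCompletion L))) = JI.map ((↑) : 𝒪[(w.1.adicCompletion L)] → (w.1.adicCompletion L)) := by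
      ext i j; rfl
    have hmul : JO * JI = 1 := by
      apply hinjO
      change (JO * JI).map ⇑(𝒪[(w.1.adicCompletion L)]).subtype = (1 : Matrix (Fin 3) (Fin 3) 𝒪[(w.1.adicCompletion L)]).map ⇑(𝒪[(w.1.adicCompletion L)]).subtype
      rw [Matrix.map_mul, Matrix.map_one (𝒪[(w.1.adicCompletion L)]).subtype (map_zero _) (map_one _)]
      change JO.map ((↑) : 𝒪[(w.1.adicCompletion L)] → (w.1.adicCompletion L)) * JI.map ((↑) : 𝒪[(w.1.adicCompletion L)] → (w.1.adicCompletion L)) = 1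
      rw [← hJ, ← hJI]
      have hmi := hH'w.unit.mul_inv
      rw [hH'w.unit_spec] at hmi
      exact hmi
    exact Matrix.isUnit_det_of_right_inverse hmul
  have hJσ : ((placeForm H' w.1).map (galAdicCompletionMap (L := L) (IsCMField.complexConj L) hw))ᵀ = (placeForm H' w.1) := placeForm_hermitian_of_smul_eq (c := IsCMField.complexConj L) w H' hH' hw
  clear_value JO
  -- §2 reduction `red : K_w → U(σ̄_w, J̄)(𝓀_w)` (★ D-T1u) and its SURJECTIVITY (★ Hensel)
  obtain ⟨red, hred⟩ := exists_unitary_residueHom (galAdicCompletionMap (L := L) (IsCMField.complexConj L) hw) (placeForm H' w.1) JO hJ σk hσO hσk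
  have hsurj : Function.Surjective red :=
    unitary_residueHom_surjective_of_isUnit_two (galAdicCompletionMap (L := L) (IsCMField.complexConj L) hw) (placeForm H' w.1) hσσ hσO σk hσk JO hJ hJσ hJOdet h2 red hred
  -- the residual form `J̄ = J_𝒪 mod 𝓂` is `σ̄`-hermitian and non-degenerate
  let τ : 𝒪[(w.1.adicCompletion L)] → 𝒪[(w.1.adicCompletion L)] := fun x => ⟨(galAdicCompletionMap (L := L) (IsCMField.complexConj L) hw) x, hσO x⟩
  have hJOτ : (JO.map τ)ᵀ = JO := by
    apply hinjO
    change ((JO.map τ)ᵀ).map ((↑) : 𝒪[(w.1.adicCompletion L)] → (w.1.adicCompletion L)) = JO.map ((↑) : 𝒪[(w.1.adicCompletion L)] → (w.1.adicCompletion L))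
    rw [Matrix.transpose_map]
    have hmm : (JO.map τ).map ((↑) : 𝒪[(w.1.adicCompletion L)] → (w.1.adicCompletion L)) = (JO.map ((↑) : 𝒪[(w.1.adicCompletion L)] → (w.1.adicCompletion L))).map (galAdicCompletionMap (L := L) (IsCMField.complexConj L) hw) := by ext i j; rfl
    rw [hmm, ← hJ]
    exact hJσ
  have hJk : ((JO.map (IsLocalRing.residue 𝒪[(w.1.adicCompletion L)])).map σk)ᵀ = JO.map (IsLocalRing.residue 𝒪[(w.1.adicCompletion L)]) := by
    have h := congrArg (fun M : Matrix (Fin 3) (Fin 3) 𝒪[(w.1.adicCompletion L)] => M.map (IsLocalRing.residue 𝒪[(w.1.adicCompletion L)])) hJOτ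
    simp only [Matrix.transpose_map, Matrix.map_map] at h
    have hcomp : (⇑(IsLocalRing.residue 𝒪[(w.1.adicCompletion L)]) ∘ τ) = (⇑σk ∘ ⇑(IsLocalRing.residue 𝒪[(w.1.adicCompletion L)])) := funext fun x => hσk x
    rw [hcomp, ← Matrix.map_map] at h
    exact h
  have hJkdet : (JO.map (IsLocalRing.residue 𝒪[(w.1.adicCompletion L)])).det ≠ 0 := by
    rw [← RingHom.mapMatrix_apply, ← RingHom.map_det]
    exact (hJOdet.map _).ne_zero
  -- §3 `K` inside the domain `U(J)(𝒪_w)` of `red`; the reduction read on it (entries = residues = `redMat`)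
  have hKI : ∀ {x : ((cmDatum L 3 H').Local v)}, x ∈ (cmLocalIntegralLevel L 3 H' v) → (((localNonsplitEquiv (IsCMField.complexConj L) H' (IsCMField.complexConj_ne_one L) w hw x) : ↥(unitaryGroupOfForm (galAdicCompletionMap (L := L) (IsCMField.complexConj L) hw) (placeForm H' w.1))) : GL (Fin 3) (w.1.adicCompletion L)) ∈ glInt 3 (w.1.adicCompletion L) := fun {x} hx =>
    (mem_localIntegralLevel_iff_of_smul_eq (IsCMField.complexConj L) 3 H' hc1 w hw x).1 hx
  have hredK : ∀ z : ↥((glInt 3 (w.1.adicCompletion L)).subgroupOf (unitaryGroupOfForm (galAdicCompletionMap (L := L) (IsCMField.complexConj L) hw) (placeForm H' w.1))), (((red z : ↥(unitaryGroupOfForm σk (JO.map (IsLocalRing.residue 𝒪[(w.1.adicCompletion L)])))) : GL (Fin 3) 𝓀[(w.1.adicCompletion L)]) : Matrix (Fin 3) (Fin 3) 𝓀[(w.1.adicCompletion L)]) = redMat ((((z : ↥((glInt 3 (w.1.adicCompletion L)).subgroupOf (unitaryGroupOfForm (galAdicCompletionMap (L := L) (IsCMField.complexConj L) hw) (placeForm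 H' w.1)))) : ↥(unitaryGroupOfForm (galAdicCompletionMap (L := L) (IsCMField.complexConj L) hw) (placeForm H' w.1))) : GL (Fin 3) (w.1.adicCompletion L)) : Matrix (Fin 3) (Fin 3) (w.1.adicCompletion L)) := by
    intro z
    ext i j
    rw [hred]
    exact (red_coe _).symm
  -- opaque names for the images of `k, k′` (keeps every later rewrite syntactic)
  obtain ⟨xk, hxk⟩ : ∃ z : ↥((glInt 3 (w.1.adicCompletion L)).subgroupOf (unitaryGroupOfForm (galAdicCompletionMap (L := L) (IsCMField.complexConj L) hw) (placeForm H' w.1))), (z : ↥(unitaryGroupOfForm (galAdicCompletionMap (L := L) (IsCMField.complexConj L) hw) (placeForm H' w.1))) = (localNonsplitEquiv (IsCMField.complexConj L) H' (IsCMField.complexConj_ne_one L) w hw k) := ⟨⟨(localNonsplitEquiv (IsCMField.complexConj L) H' (IsCMField.complexConj_ne_one L) w hw k), hKI hk⟩, rfl⟩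
  obtain ⟨xk', hxk'⟩ : ∃ z : ↥((glInt 3 (w.1.adicCompletion L)).subgroupOf (unitaryGroupOfForm (galAdicCompletionMap (L := L) (IsCMField.complexConj L) hw) (placeForm H' w.1))), (z : ↥(unitaryGroupOfForm (galAdicCompletionMap (L := L) (IsCMField.complexConj L) hw) (placeForm H' w.1))) = (localNonsplitEquiv (IsCMField.complexConj L) H' (IsCMField.complexConj_ne_one L) w hw k') := ⟨⟨(localNonsplitEquiv (IsCMField.complexConj L) H' (IsCMField.complexConj_ne_one L) w hw k'), hKI hk'⟩, rfl⟩
  -- §4 the residual conjugator, lifted to `K` (Hensel ★ p846840)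
  obtain ⟨h, hhO, hhconj⟩ := hconj
  have hJred : redMat (placeForm H' w.1) = JO.map (IsLocalRing.residue 𝒪[(w.1.adicCompletion L)]) := by
    rw [hJ]; exact redMat_mapMatrix JO
  have hh : h ∈ unitaryGroupOfForm σk (JO.map (IsLocalRing.residue 𝒪[(w.1.adicCompletion L)])) := by
    rw [hid, ← hJred]; exact hhO
  obtain ⟨xy, hxy⟩ := hsurj ⟨h, hh⟩
  obtain ⟨y, hydef⟩ : ∃ y : ((cmDatum L 3 H').Local v), y = (localNonsplitEquiv (IsCMField.complexConj L) H' (IsCMField.complexConj_ne_one L) w hw).symm (xy : ↥(unitaryGroupOfForm (galAdicCompletionMap (L := L) (IsCMField.complexConj L) hw) (placeForm H' w.1))) := ⟨_, rfl⟩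
  have hey : (localNonsplitEquiv (IsCMField.complexConj L) H' (IsCMField.complexConj_ne_one L) w hw) y = (xy : ↥(unitaryGroupOfForm (galAdicCompletionMap (L := L) (IsCMField.complexConj L) hw) (placeForm H' w.1))) := by
    rw [hydef]; exact (localNonsplitEquiv (IsCMField.complexConj L) H' (IsCMField.complexConj_ne_one L) w hw).apply_symm_apply _
  have hy : y ∈ (cmLocalIntegralLevel L 3 H' v) := by
    refine (mem_localIntegralLevel_iff_of_smul_eq (IsCMField.complexConj L) 3 H' hc1 w hw y).2 ?_
    rw [hey]; exact xy.2
  -- §5 `z = y k y⁻¹` and its `w`-matrix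
  have he1 : (localNonsplitEquiv (IsCMField.complexConj L) H' (IsCMField.complexConj_ne_one L) w hw) (y * k) = (xy : ↥(unitaryGroupOfForm (galAdicCompletionMap (L := L) (IsCMField.complexConj L) hw) (placeForm H' w.1))) * (xk : ↥(unitaryGroupOfForm (galAdicCompletionMap (L := L) (IsCMField.complexConj L) hw) (placeForm H' w.1))) := by
    rw [← hey, hxk]; exact map_mul _ y k
  have he2 : (localNonsplitEquiv (IsCMField.complexConj L) H' (IsCMField.complexConj_ne_one L) w hw) (y⁻¹) = (xy : ↥(unitaryGroupOfForm (galAdicCompletionMap (L := L) (IsCMField.complexConj L) hw) (placeForm H' w.1)))⁻¹ := by rw [← hey]; exact map_inv _ y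
  have he3 : (localNonsplitEquiv (IsCMField.complexConj L) H' (IsCMField.complexConj_ne_one L) w hw) (y * k * y⁻¹) = (xy : ↥(unitaryGroupOfForm (galAdicCompletionMap (L := L) (IsCMField.complexConj L) hw) (placeForm H' w.1))) * (xk : ↥(unitaryGroupOfForm (galAdicCompletionMap (L := L) (IsCMField.complexConj L) hw) (placeForm H' w.1))) * (xy : ↥(unitaryGroupOfForm (galAdicCompletionMap (L := L) (IsCMField.complexConj L) hw) (placeForm H' w.1)))⁻¹ := by
    rw [← he1, ← he2]; exact map_mul _ (y * k) y⁻¹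
  -- names for the matrices of `y, y⁻¹, k, k′, z = yky⁻¹, z⁻¹`
  obtain ⟨My, hMy⟩ : ∃ M : Matrix (Fin 3) (Fin 3) (w.1.adicCompletion L), M = (((xy : ↥(unitaryGroupOfForm (galAdicCompletionMap (L := L) (IsCMField.complexConj L) hw) (placeForm H' w.1))) : GL (Fin 3) (w.1.adicCompletion L)) : Matrix (Fin 3) (Fin 3) (w.1.adicCompletion L)) := ⟨_, rfl⟩
  obtain ⟨Myi, hMyi⟩ : ∃ M : Matrix (Fin 3) (Fin 3) (w.1.adicCompletion L), M = ((((xy : ↥(unitaryGroupOfForm (galAdicCompletionMap (L := L) (IsCMField.complexConj L) hw) (placeForm H' w.1)))⁻¹ : ↥(unitaryGroupOfForm (galAdicCompletionMap (L := L) (IsCMField.complexConj L) hw) (placeForm H' w.1))) : GL (Fin 3) (w.1.adicCompletion L)) : Matrix (Fin 3) (Fin 3) (w.1.adicCompletion L)) := ⟨_, rfl⟩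
  obtain ⟨Mk, hMkd⟩ : ∃ M : Matrix (Fin 3) (Fin 3) (w.1.adicCompletion L), M = (((xk : ↥(unitaryGroupOfForm (galAdicCompletionMap (L := L) (IsCMField.complexConj L) hw) (placeForm H' w.1))) : GL (Fin 3) (w.1.adicCompletion L)) : Matrix (Fin 3) (Fin 3) (w.1.adicCompletion L)) := ⟨_, rfl⟩
  obtain ⟨Mk', hMk'd⟩ : ∃ M : Matrix (Fin 3) (Fin 3) (w.1.adicCompletion L), M = (((xk' : ↥(unitaryGroupOfForm (galAdicCompletionMap (L := L) (IsCMField.complexConj L) hw) (placeForm H' w.1))) : GL (Fin 3) (w.1.adicCompletion L)) : Matrix (Fin 3) (Fin 3) (w.1.adicCompletion L)) := ⟨_, rfl⟩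
  obtain ⟨Mz, hMz⟩ : ∃ M : Matrix (Fin 3) (Fin 3) (w.1.adicCompletion L), M = ((((localNonsplitEquiv (IsCMField.complexConj L) H' (IsCMField.complexConj_ne_one L) w hw) (y * k * y⁻¹) : ↥(unitaryGroupOfForm (galAdicCompletionMap (L := L) (IsCMField.complexConj L) hw) (placeForm H' w.1))) : GL (Fin 3) (w.1.adicCompletion L)) : Matrix (Fin 3) (Fin 3) (w.1.adicCompletion L)) := ⟨_, rfl⟩
  obtain ⟨Mzi, hMzi⟩ : ∃ M : Matrix (Fin 3) (Fin 3) (w.1.adicCompletion L), M = (((((localNonsplitEquiv (IsCMField.complexConj L) H' (IsCMField.complexConj_ne_one L) w hw) (y * k * y⁻¹))⁻¹ : ↥(unitaryGroupOfForm (galAdicCompletionMap (L := L) (IsCMField.complexConj L) hw) (placeForm H' w.1))) : GL (Fin 3) (w.1.adicCompletion L)) : Matrix (Fin 3) (Fin 3) (w.1.adicCompletion L)) := ⟨_, rfl⟩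
  -- unit relations
  have hunit : ∀ a : ↥(unitaryGroupOfForm (galAdicCompletionMap (L := L) (IsCMField.complexConj L) hw) (placeForm H' w.1)), ((a : GL (Fin 3) (w.1.adicCompletion L)) : Matrix (Fin 3) (Fin 3) (w.1.adicCompletion L)) * (((a⁻¹ : ↥(unitaryGroupOfForm (galAdicCompletionMap (L := L) (IsCMField.complexConj L) hw) (placeForm H' w.1))) : GL (Fin 3) (w.1.adicCompletion L)) : Matrix (Fin 3) (Fin 3) (w.1.adicCompletion L)) = 1 := fun a => by
    rw [Subgroup.coe_inv, ← Units.val_mul, mul_inv_cancel, Units.val_one]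
  have hyyi : My * Myi = 1 := by rw [hMy, hMyi]; exact hunit _
  have hzzi : Mz * Mzi = 1 := by rw [hMz, hMzi]; exact hunit _
  have hMzprod : Mz = My * Mk * Myi := by
    rw [hMz, he3, hMy, hMkd, hMyi, Subgroup.coe_mul, Subgroup.coe_mul, Units.val_mul, Units.val_mul]
  -- the stub spellings of `k_w, k′_w` are these matrices
  have hMkspell : (((k).val : GL (Fin 3) (UnitaryGroup.LocalRing L v)).val.map (Pi.evalRingHom (fun w' : PlacesOver L v => w'.1.adicCompletion L) w)) = Mk := by
    rw [hMkd, hxk]; exact (coe_localNonsplitEquiv_apply L H' v w hw k).symm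
  have hMk'spell : (((k').val : GL (Fin 3) (UnitaryGroup.LocalRing L v)).val.map (Pi.evalRingHom (fun w' : PlacesOver L v => w'.1.adicCompletion L) w)) = Mk' := by
    rw [hMk'd, hxk']; exact (coe_localNonsplitEquiv_apply L H' v w hw k').symm
  -- integrality
  have hVy : ValBound 1 My := by rw [hMy]; exact valBound_one_of_mem_glInt (Subgroup.mem_subgroupOf.1 xy.2)
  have hVyi : ValBound 1 Myi := by
    rw [hMyi]; exact valBound_one_of_mem_glInt (Subgroup.mem_subgroupOf.1 (Subgroup.inv_mem _ xy.2))
  have hzK : y * k * y⁻¹ ∈ (cmLocalIntegralLevel L 3 H' v) := Subgroup.mul_mem _ (Subgroup.mul_mem _ hy hk) (Subgroup.inv_mem _ hy)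
  have hVzi : ValBound 1 Mzi := by
    rw [hMzi, Subgroup.coe_inv]; exact valBound_one_of_mem_glInt (Subgroup.inv_mem _ (hKI hzK))
  have hval1 : ∀ {x : (w.1.adicCompletion L)}, Valued.v x ≤ 1 → valuation (w.1.adicCompletion L) x ≤ 1 := fun {x} hx => by
    have h := (v_le_iff_valuation_le x 1).1 (by rwa [map_one]); rwa [map_one] at h
  have hAk : ValBound 1 (ϖ⁻¹ • (Mk - 1)) := fun a b => by
    rw [Matrix.smul_apply, smul_eq_mul, Matrix.sub_apply, ← hMkspell]; exact hval1 (hk1 a b)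
  have hAk' : ValBound 1 (ϖ⁻¹ • (Mk' - 1)) := fun a b => by
    rw [Matrix.smul_apply, smul_eq_mul, Matrix.sub_apply, ← hMk'spell]; exact hval1 (hk1' a b)
  -- `ϖ⁻¹(Mz − 1) = My · ϖ⁻¹(Mk − 1) · Myi`
  have hconjM : ϖ⁻¹ • (Mz - 1) = My * (ϖ⁻¹ • (Mk - 1)) * Myi := by
    rw [hMzprod, Matrix.mul_smul, Matrix.smul_mul, Matrix.mul_sub, Matrix.sub_mul, Matrix.mul_one, hyyi]
  have hVBz : ValBound 1 (ϖ⁻¹ • (Mz - 1)) := by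
    rw [hconjM]
    have h := (hVy.mul hAk).mul hVyi
    rwa [one_mul, one_mul] at h
  -- residues: `red My = h`, `red Myi = h⁻¹`
  have hredy : redMat My = ((h : GL (Fin 3) 𝓀[(w.1.adicCompletion L)]) : Matrix (Fin 3) (Fin 3) 𝓀[(w.1.adicCompletion L)]) := by
    rw [hMy, ← hredK xy, hxy]
  have hredyi : redMat Myi = (((h⁻¹ : GL (Fin 3) 𝓀[(w.1.adicCompletion L)])) : Matrix (Fin 3) (Fin 3) 𝓀[(w.1.adicCompletion L)]) := by
    have hm : redMat My * redMat Myi = 1 := by rw [← redMat_mul hVy hVyi, hyyi, redMat_one]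
    rw [hredy] at hm
    calc redMat Myi = (((h⁻¹ : GL (Fin 3) 𝓀[(w.1.adicCompletion L)])) : Matrix (Fin 3) (Fin 3) 𝓀[(w.1.adicCompletion L)]) * (((h : GL (Fin 3) 𝓀[(w.1.adicCompletion L)]) : Matrix (Fin 3) (Fin 3) 𝓀[(w.1.adicCompletion L)]) * redMat Myi) := by
          rw [← Matrix.mul_assoc, ← Units.val_mul, inv_mul_cancel, Units.val_one, Matrix.one_mul]
      _ = (((h⁻¹ : GL (Fin 3) 𝓀[(w.1.adicCompletion L)])) : Matrix (Fin 3) (Fin 3) 𝓀[(w.1.adicCompletion L)]) := by rw [hm, Matrix.mul_one]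
  -- THE KEY RESIDUAL IDENTITY `N(z) = N(k′)`
  have hredz : redMat (ϖ⁻¹ • (Mz - 1)) = redMat (ϖ⁻¹ • (Mk' - 1)) := by
    have h1 : ValBound 1 (My * (ϖ⁻¹ • (Mk - 1))) := by have h := hVy.mul hAk; rwa [one_mul] at h
    rw [hconjM, redMat_mul h1 hVyi, redMat_mul hVy hAk, hredy, hredyi, ← hMkspell, ← hMk'spell]
    exact hhconj
  -- §6 `u = k′ z⁻¹ ≡ 1 (ϖ_w²)`
  obtain ⟨u, hudef⟩ : ∃ u : ((cmDatum L 3 H').Local v), u = k' * (y * k * y⁻¹)⁻¹ := ⟨_, rfl⟩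
  have heu : (localNonsplitEquiv (IsCMField.complexConj L) H' (IsCMField.complexConj_ne_one L) w hw) u = (xk' : ↥(unitaryGroupOfForm (galAdicCompletionMap (L := L) (IsCMField.complexConj L) hw) (placeForm H' w.1))) * ((localNonsplitEquiv (IsCMField.complexConj L) H' (IsCMField.complexConj_ne_one L) w hw) (y * k * y⁻¹))⁻¹ := by
    rw [hudef, hxk']
    have h1 : (localNonsplitEquiv (IsCMField.complexConj L) H' (IsCMField.complexConj_ne_one L) w hw) (k' * (y * k * y⁻¹)⁻¹) =
        (localNonsplitEquiv (IsCMField.complexConj L) H' (IsCMField.complexConj_ne_one L) w hw) k' * (localNonsplitEquiv (IsCMField.complexConj L) H' (IsCMField.complexConj_ne_one L) w hw) ((y * k * y⁻¹)⁻¹) :=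
      map_mul _ _ _
    have h2 : (localNonsplitEquiv (IsCMField.complexConj L) H' (IsCMField.complexConj_ne_one L) w hw) ((y * k * y⁻¹)⁻¹) =
        ((localNonsplitEquiv (IsCMField.complexConj L) H' (IsCMField.complexConj_ne_one L) w hw) (y * k * y⁻¹))⁻¹ := map_inv _ _
    rw [h1, h2]
  have hMu : ((((localNonsplitEquiv (IsCMField.complexConj L) H' (IsCMField.complexConj_ne_one L) w hw) u : ↥(unitaryGroupOfForm (galAdicCompletionMap (L := L) (IsCMField.complexConj L) hw) (placeForm H' w.1))) : GL (Fin 3) (w.1.adicCompletion L)) : Matrix (Fin 3) (Fin 3) (w.1.adicCompletion L)) = Mk' * Mzi := by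
    rw [heu, hMk'd, hMzi, Subgroup.coe_mul, Units.val_mul]
  have hϖv1 : valuation (w.1.adicCompletion L) ϖ < 1 := hϖu.valuation_lt_one
  have hϖne : ϖ ≠ 0 := fun h0 => by rw [h0, map_zero] at hϖ; exact WithZero.coe_ne_zero hϖ.symm
  -- `A − B ≡ 0 (ϖ)`: entries of valuation `≤ |ϖ|`
  have hdiff : ∀ a b, valuation (w.1.adicCompletion L) ((ϖ⁻¹ • (Mk' - 1) - ϖ⁻¹ • (Mz - 1)) a b) ≤ valuation (w.1.adicCompletion L) ϖ := by
    have hz : redMat (ϖ⁻¹ • (Mk' - 1) - ϖ⁻¹ • (Mz - 1)) = 0 := by rw [redMat_sub hAk' hVBz, hredz, sub_self]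
    have hlt := (redMat_eq_zero_iff_forall_valuation_lt_one (hAk'.sub hVBz)).1 hz
    have hlt1 : ∀ x : (w.1.adicCompletion L), valuation (w.1.adicCompletion L) x < 1 → valuation (w.1.adicCompletion L) x ≤ valuation (w.1.adicCompletion L) ϖ :=
      fun x hx => by
        obtain ⟨q, hq, rfl⟩ := hϖu.exists_eq_mul ((Valuation.mem_integer_iff _ _).2 hx.le) hx
        rw [map_mul]
        exact mul_le_of_le_one_right' ((Valuation.mem_integer_iff _ _).1 hq)
    exact fun a b => hlt1 _ (hlt a b)
  -- the second-order quotient `C = ϖ⁻²(Mk′ − Mz)` is integral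
  have hC : ValBound 1 ((ϖ ^ 2)⁻¹ • (Mk' - Mz)) := fun a b => by
    have hsub : Mk' - Mz = ϖ • (ϖ⁻¹ • (Mk' - 1) - ϖ⁻¹ • (Mz - 1)) := by
      rw [← smul_sub, smul_smul, mul_inv_cancel₀ hϖne, one_smul, sub_sub_sub_cancel_right]
    rw [hsub, smul_smul, Matrix.smul_apply, smul_eq_mul, map_mul]
    have hsc : valuation (w.1.adicCompletion L) ((ϖ ^ 2)⁻¹ * ϖ) * valuation (w.1.adicCompletion L) ϖ = 1 := by
      rw [← map_mul, mul_assoc, ← pow_two, inv_mul_cancel₀ (pow_ne_zero 2 hϖne), map_one]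
    calc valuation (w.1.adicCompletion L) ((ϖ ^ 2)⁻¹ * ϖ) * valuation (w.1.adicCompletion L) ((ϖ⁻¹ • (Mk' - 1) - ϖ⁻¹ • (Mz - 1)) a b)
        ≤ valuation (w.1.adicCompletion L) ((ϖ ^ 2)⁻¹ * ϖ) * valuation (w.1.adicCompletion L) ϖ := by gcongr; exact hdiff a b
      _ = 1 := hsc
  have hMu1 : (ϖ ^ 2)⁻¹ • (((((localNonsplitEquiv (IsCMField.complexConj L) H' (IsCMField.complexConj_ne_one L) w hw) u : ↥(unitaryGroupOfForm (galAdicCompletionMap (L := L) (IsCMField.complexConj L) hw) (placeForm H' w.1))) : GL (Fin 3) (w.1.adicCompletion L)) : Matrix (Fin 3) (Fin 3) (w.1.adicCompletion L)) - 1) = ((ϖ ^ 2)⁻¹ • (Mk' - Mz)) * Mzi := by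
    rw [hMu, Matrix.smul_mul, Matrix.sub_mul, hzzi]
  have hVu : ValBound 1 ((ϖ ^ 2)⁻¹ • (((((localNonsplitEquiv (IsCMField.complexConj L) H' (IsCMField.complexConj_ne_one L) w hw) u : ↥(unitaryGroupOfForm (galAdicCompletionMap (L := L) (IsCMField.complexConj L) hw) (placeForm H' w.1))) : GL (Fin 3) (w.1.adicCompletion L)) : Matrix (Fin 3) (Fin 3) (w.1.adicCompletion L)) - 1)) := by
    rw [hMu1]; have h := hC.mul hVzi; rwa [one_mul] at h
  have hg2u : ∀ x, g (u * x) = g x := by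
    refine hg2w u fun a b => ?_
    have hab := hVu a b
    rw [Matrix.smul_apply, smul_eq_mul, Matrix.sub_apply] at hab
    have hval2 : ∀ {x : (w.1.adicCompletion L)}, valuation (w.1.adicCompletion L) x ≤ 1 → Valued.v x ≤ 1 := fun {x} hx => by
      have h' := (v_le_iff_valuation_le x 1).2 (by rwa [map_one])
      rwa [map_one] at h'
    exact hval2 hab
  -- §7 assemble
  calc g k = g (y * k * y⁻¹) := (hginv y hy k).symm
    _ = g (u * (y * k * y⁻¹)) := (hg2u _).symm
    _ = g k' := by rw [hudef]; exact congrArg g (inv_mul_cancel_right _ _)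


end Literature.NumberTheory.Rogawski1990

end
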